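import Literature.NumberTheory.LFunctions.MoebiusWalshTypeIIZeroBound
import Literature.NumberTheory.LFunctions.MoebiusWalshTypeIBoxBound
import Literature.NumberTheory.LFunctions.MoebiusWalshWindows
import HarnessLib

/-!
# Bourgain 2013, Theorem 1 with a free exponent: the per-box bounds of the assembly (§§2–3),
# conditionally on the shifted-window type-II estimate

Topic `Literature/NumberTheory/LFunctions`; proofs-only (theorems, no definition, no named fact).
J. Bourgain, *Möbius–Walsh correlation bounds and an estimate of Mauduit and Rivat*, J. Anal.
Math. **119** (2013) 147–163 (= arXiv:1109.2784) [Bourgain2013MoebiusWalsh], §2 (2.29)–(2.31),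
(2.34)–(2.35) and §3 (3.1)–(3.4), (3.9): how the per-box estimates are chosen for the LARGE
dyadic boxes `D_i × D_j`, `i + j < n ≤ i + j + ρ`, of the tree's Vaughan criterion
(`LiouvilleWalsh.abs_walshSum_liouville_le_of_boxBounds`), for a digit set of LARGE weight.

The shifted-window (`K ≥ μ - ρ`) type-II estimate of §2 ((2.23)–(2.28)) enters as an explicit
HYPOTHESIS `hHigh` of the theorems (its printed shape (2.28): relative saving
`L^{-cε} + L^C M^{-c} + L^C 2^{-c|S ∩ [K, K+μ+ρ')|}` up to `λ^{O(1)}`, squared, for the box sums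
`boxSum T i j α β` with `|α|, |β| ≤ 1`, `Aρ ≤ i ≤ j`, `i - ρ ≤ K ≤ j - ρ`, the digit count taken
on the core window `[K, K+i)` only — the weakest form); the
unshifted window `K = 0` is the tree's `boxSum_sq_typeII_zero_bound`. Given it:

* `typeII_box_le` — (2.29)–(2.31)/(2.34): a type-II box (`i, j ≥ i₀`, arbitrary coefficients of
  modulus `≤ 1`) whose digit set has more than `w(n/i₀ + 3) + ρ + 2` digits below `i + j + 2` is
  `≤ 2ⁿ · 40(n+2)^{A+1} / 4^{s₁}`: by the pigeonhole `exists_heavy_window` some window carries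
  `> w` digits, and the corresponding estimate (`K = 0` or `hHigh`) saves `2^{-s₁}`;
* `typeI_box_le` — §3: a type-I box (`i ≤ 2i₀`, divisor-bounded coefficient) whose digit set has
  `≥ s_I` digits below `i + j + 2` is `≤ 2ⁿ · 12(n+2)^{A+3} / 2^{s₁}`: crude regime `i ≤ i₁`
  ((3.2')–(3.3)), refined regime under (3.4) ((3.8)–(3.9)), and otherwise a heavy top window and
  `hHigh` ((2.35), through `abs_boxSum_divisorBounded_le_of_typeII`).

All parameter constraints are hypotheses (numerical, on `n, ρ = 4ρ₄, s₁, w, i₀, i₁, s_I, b`); the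
choice of the parameters as functions of `n` and the small-weight case are not in this file.

## References

* J. Bourgain, J. Anal. Math. 119 (2013) 147–163, §2 (2.28)–(2.35), §3. [Bourgain2013MoebiusWalsh]
-/

noncomputable section

open Finset Real
open scoped ArithmeticFunction.sigma

namespace Literature.NumberTheory.LFunctions.MoebiusWalshTypeII

open Literature.NumberTheory.LFunctions.MoebiusWalshVaughan (natWalsh dyBlock mem_dyBlock boxSum
  abs_natWalsh_le)
open Literature.NumberTheory.LFunctions.MoebiusWalsh (walshSupExponent walshSupExponent_pos
  boxSum_comm boxSum_eq_boxSum_filter)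

/-! ### Small helpers -/

/-- From `x² ≤ 4^{i+j} Z` and `Z ≤ E²`, `E ≥ 0`: `|x| ≤ 2^{i+j} E`. [folklore] -/
theorem abs_le_of_sq_le_four_pow {x Z E : ℝ} {i j : ℕ} (h : x ^ 2 ≤ 4 ^ (i + j) * Z)
    (hZ : Z ≤ E ^ 2) (hE : 0 ≤ E) : |x| ≤ 2 ^ (i + j) * E := by
  have h4 : (4 : ℝ) ^ (i + j) = ((2 : ℝ) ^ (i + j)) ^ 2 := by
    rw [← pow_mul, show (4 : ℝ) = 2 ^ 2 by norm_num, ← pow_mul, mul_comm]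
  refine abs_le_of_sq_le_sq ?_ (by positivity)
  calc x ^ 2 ≤ 4 ^ (i + j) * Z := h
    _ ≤ 4 ^ (i + j) * E ^ 2 := by gcongr
    _ = (2 ^ (i + j) * E) ^ 2 := by rw [h4]; ring

/-- `√(a x) ≤ a x` for `a x ≥ 1`. [folklore] -/
theorem sqrt_le_self_of_one_le {y : ℝ} (hy : 1 ≤ y) : Real.sqrt y ≤ y := by
  rw [Real.sqrt_le_left (by linarith)]
  nlinarith

/-! ### Numerical lemmas for the two windows -/

/-- The sup-norm term of the `K = 0` estimate under `2c₂w ≥ 58ρ + 8`, `ρ = 4ρ₄`, `w ≤ cnt`: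
`32·2^{57ρ}(2·2^{-c₂ cnt})² ≤ 1/2^{2ρ₄}`. [cite: Bourgain2013MoebiusWalsh, §2 (2.22)] -/
theorem eta_bottom_le {ρ₄ w cnt : ℕ}
    (hw0 : (58 * (4 * ρ₄ : ℕ) + 8 : ℝ) ≤ 2 * walshSupExponent * w) (hcnt : w ≤ cnt) :
    32 * (2 : ℝ) ^ (54 * (4 * ρ₄) + 3 * (4 * ρ₄)) *
        (2 * (2 : ℝ) ^ (-(walshSupExponent * (cnt : ℝ)))) ^ 2 ≤ 1 / 2 ^ (2 * ρ₄) := by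
  have hc : 0 ≤ walshSupExponent := walshSupExponent_pos.le
  have hcnt' : (w : ℝ) ≤ cnt := by exact_mod_cast hcnt
  have h1 : (2 * (2 : ℝ) ^ (-(walshSupExponent * (cnt : ℝ)))) ^ 2 =
      (2 : ℝ) ^ (2 : ℝ) * (2 : ℝ) ^ (-(2 * walshSupExponent * cnt)) := by
    rw [mul_pow, ← Real.rpow_natCast ((2 : ℝ) ^ (-(walshSupExponent * (cnt : ℝ)))) 2,
      ← Real.rpow_mul (by norm_num)]
    norm_num
    ring_nf
  rw [h1, show (32 : ℝ) = (2 : ℝ) ^ (5 : ℝ) by norm_num, two_pow_eq_rpow, one_div,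
    two_pow_eq_rpow (2 * ρ₄), ← Real.rpow_neg (by norm_num)]
  simp only [mul_assoc, two_rpow_mul_two_rpow]
  refine two_rpow_le_two_rpow ?_
  have h2 : 2 * walshSupExponent * w ≤ 2 * walshSupExponent * cnt := by nlinarith
  push_cast at hw0 ⊢
  linarith

/-- The bracket of the `K = 0` estimate: with `ρ = 4ρ₄ ≥ 4`, `6ρ₄ ≤ j` and a sup-norm term
`≤ 1/2^{2ρ₄}`, `324/2^{ρ/2} + 24/2^ρ + 48·2^ρ/2^j + η-term ≤ (20/2^{ρ₄})²`. [folklore] -/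
theorem bracket_bottom_le {ρ₄ j : ℕ} (hρ₄ : 1 ≤ ρ₄) (hj : 4 * ρ₄ + 2 * ρ₄ ≤ j) {H : ℝ}
    (hH : H ≤ 1 / 2 ^ (2 * ρ₄)) :
    324 / (2 : ℝ) ^ (4 * ρ₄ / 2) + 24 / 2 ^ (4 * ρ₄) + 48 * 2 ^ (4 * ρ₄) / 2 ^ j + H ≤
      (20 / 2 ^ ρ₄) ^ 2 := by
  have hdiv : 4 * ρ₄ / 2 = 2 * ρ₄ := by omega
  rw [hdiv]
  set D : ℝ := (2 : ℝ) ^ (2 * ρ₄) with hD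
  have hD0 : 0 < D := by positivity
  have hDsq : ((2 : ℝ) ^ ρ₄) ^ 2 = D := by rw [hD, ← pow_mul, mul_comm]
  have h1 : (24 : ℝ) / 2 ^ (4 * ρ₄) ≤ 24 / D :=
    div_le_div_of_nonneg_left (by norm_num) hD0 (pow_le_pow_right₀ one_le_two (by omega))
  have h2 : 48 * (2 : ℝ) ^ (4 * ρ₄) / 2 ^ j ≤ 48 / D := by
    rw [div_le_div_iff₀ (by positivity) hD0]
    calc 48 * (2 : ℝ) ^ (4 * ρ₄) * D = 48 * 2 ^ (4 * ρ₄ + 2 * ρ₄) := by rw [hD, pow_add]; ring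
      _ ≤ 48 * 2 ^ j := by gcongr; norm_num
  calc 324 / D + 24 / 2 ^ (4 * ρ₄) + 48 * 2 ^ (4 * ρ₄) / 2 ^ j + H
      ≤ 324 / D + 24 / D + 48 / D + 1 / D := by gcongr
    _ = 397 / D := by ring
    _ ≤ 400 / D := div_le_div_of_nonneg_right (by norm_num) hD0.le
    _ = (20 / 2 ^ ρ₄) ^ 2 := by rw [div_pow, hDsq]; norm_num

/-- The bracket of the shifted-window estimate: with `ch·i₀ ≥ (A+ch)ρ`, `i₀ ≤ i`,
`ch·w ≥ (A+ch)ρ`, `w < cnt`: `2^{-chρ} + 2^{Aρ}(2^{-ch i} + 2^{-ch cnt}) ≤ 3·2^{-chρ}`.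
[cite: Bourgain2013MoebiusWalsh, §2 (2.28)–(2.31)] -/
theorem bracket_high_le {Ah ρ i i₀ w cnt : ℕ} {ch : ℝ} (hch : 0 < ch)
    (hAi₀ : (Ah : ℝ) * ρ + ch * ρ ≤ ch * i₀) (hi : i₀ ≤ i)
    (hw1 : (Ah : ℝ) * ρ + ch * ρ ≤ ch * w) (hcnt : w < cnt) :
    (2 : ℝ) ^ (-(ch * ρ)) + 2 ^ (Ah * ρ) * ((2 : ℝ) ^ (-(ch * i)) + (2 : ℝ) ^ (-(ch * (cnt : ℝ)))) ≤
      3 * (2 : ℝ) ^ (-(ch * ρ)) := by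
  have hi' : (i₀ : ℝ) ≤ i := by exact_mod_cast hi
  have hcnt' : (w : ℝ) ≤ cnt := by exact_mod_cast hcnt.le
  have hA : (2 : ℝ) ^ (Ah * ρ) = (2 : ℝ) ^ ((Ah : ℝ) * ρ) := by
    rw [two_pow_eq_rpow]; push_cast; ring_nf
  have h1 : (2 : ℝ) ^ (Ah * ρ) * (2 : ℝ) ^ (-(ch * i)) ≤ (2 : ℝ) ^ (-(ch * ρ)) := by
    rw [hA, two_rpow_mul_two_rpow]
    exact two_rpow_le_two_rpow (by nlinarith)
  have h2 : (2 : ℝ) ^ (Ah * ρ) * (2 : ℝ) ^ (-(ch * (cnt : ℝ))) ≤ (2 : ℝ) ^ (-(ch * ρ)) := by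
    rw [hA, two_rpow_mul_two_rpow]
    exact two_rpow_le_two_rpow (by nlinarith)
  calc (2 : ℝ) ^ (-(ch * ρ)) + 2 ^ (Ah * ρ) * ((2 : ℝ) ^ (-(ch * i)) + (2 : ℝ) ^ (-(ch * (cnt : ℝ))))
      = (2 : ℝ) ^ (-(ch * ρ)) + ((2 : ℝ) ^ (Ah * ρ) * (2 : ℝ) ^ (-(ch * i)) +
          (2 : ℝ) ^ (Ah * ρ) * (2 : ℝ) ^ (-(ch * (cnt : ℝ)))) := by ring
    _ ≤ (2 : ℝ) ^ (-(ch * ρ)) + ((2 : ℝ) ^ (-(ch * ρ)) + (2 : ℝ) ^ (-(ch * ρ))) := by gcongr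
    _ = 3 * (2 : ℝ) ^ (-(ch * ρ)) := by ring

/-- `3·2^{-chρ} ≤ (2/2^{2s₁})²` when `4s₁ ≤ chρ`. [folklore] -/
theorem three_mul_two_rpow_le {ρ s₁ : ℕ} {ch : ℝ} (hch4 : (4 * s₁ : ℝ) ≤ ch * ρ) :
    3 * (2 : ℝ) ^ (-(ch * ρ)) ≤ (2 / 2 ^ (2 * s₁)) ^ 2 := by
  have h1 : (2 : ℝ) ^ (-(ch * ρ)) ≤ 1 / 2 ^ (4 * s₁) := by
    rw [one_div, two_pow_eq_rpow, ← Real.rpow_neg (by norm_num)]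
    exact two_rpow_le_two_rpow (by push_cast; linarith)
  have h2 : ((2 : ℝ) / 2 ^ (2 * s₁)) ^ 2 = 4 / 2 ^ (4 * s₁) := by
    rw [div_pow, ← pow_mul, show 2 * s₁ * 2 = 4 * s₁ by ring]; norm_num
  rw [h2]
  calc 3 * (2 : ℝ) ^ (-(ch * ρ)) ≤ 3 * (1 / 2 ^ (4 * s₁)) := by gcongr
    _ ≤ 4 / 2 ^ (4 * s₁) := by rw [mul_one_div]; gcongr; norm_num

/-! ### The type-II boxes (Bourgain 2013, (2.29)–(2.31)) -/

set_option maxHeartbeats 400000 in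
/-- **A large type-II box with a heavy digit set** (Bourgain 2013, (2.29)–(2.31), (2.34)).
Hypothesis `hHigh` is the shifted-window type-II estimate of §2 ((2.23)–(2.28)) in per-box form.
For `ρ = 4ρ₄`, thresholds `i₀ ≥ 50ρ, Aρ`, window weight `w` with `2c₂w ≥ 58ρ + 8` and
`ch·w ≥ (A + ch)ρ`, `ch·i₀ ≥ (A + ch)ρ`, `4s₁ ≤ ch·ρ`, `2s₁ ≤ ρ₄`: every box `i, j ≥ i₀`, `i + j < n`,
whose digit set has `> w(n/i₀ + 3) + ρ + 2` digits below `i + j + 2`, satisfies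
`|boxSum T i j α β| ≤ 2ⁿ · 40(n+2)^{A+1}/4^{s₁}` for all `|α|, |β| ≤ 1` (`2s₁ ≤ ρ₄`).
[cite: Bourgain2013MoebiusWalsh, §2 (2.29)–(2.31), (2.34)] -/
theorem typeII_box_le {Ah : ℕ} {ch : ℝ} (hch : 0 < ch)
    (hHigh : ∀ (T : Finset ℕ) (i j ρ K : ℕ), 1 ≤ ρ → Ah * ρ ≤ i → i ≤ j → i ≤ K + ρ → K + ρ ≤ j →
      ∀ (α β : ℕ → ℝ), (∀ a, |α a| ≤ 1) → (∀ b, |β b| ≤ 1) →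
        (boxSum T i j α β) ^ 2 ≤ 4 ^ (i + j) * ((i + j + 2 : ℕ) : ℝ) ^ Ah *
          ((2 : ℝ) ^ (-(ch * ρ)) + 2 ^ (Ah * ρ) * ((2 : ℝ) ^ (-(ch * i)) +
            (2 : ℝ) ^ (-(ch * ((T.filter (fun x => K ≤ x ∧ x < K + i)).card : ℝ))))))
    {n ρ₄ s₁ w i₀ : ℕ} (hρ₄ : 1 ≤ ρ₄) (hs : 2 * s₁ ≤ ρ₄) (hch4 : (4 * s₁ : ℝ) ≤ ch * (4 * ρ₄ : ℕ))
    (h50 : 50 * (4 * ρ₄) ≤ i₀) (hAρ : Ah * (4 * ρ₄) ≤ i₀)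
    (hAi₀ : (Ah : ℝ) * (4 * ρ₄ : ℕ) + ch * (4 * ρ₄ : ℕ) ≤ ch * i₀)
    (hw0 : (58 * (4 * ρ₄ : ℕ) + 8 : ℝ) ≤ 2 * walshSupExponent * w)
    (hw1 : (Ah : ℝ) * (4 * ρ₄ : ℕ) + ch * (4 * ρ₄ : ℕ) ≤ ch * w) (hρn : 2 * (4 * ρ₄) + 2 ≤ n)
    (T : Finset ℕ) {i j : ℕ} (hi : i₀ ≤ i) (hj : i₀ ≤ j) (hijn : i + j < n)
    (hT : w * (n / i₀ + 3) + (4 * ρ₄ + 2) < (T.filter (· < i + j + 2)).card)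
    (α β : ℕ → ℝ) (hα : ∀ a, |α a| ≤ 1) (hβ : ∀ b, |β b| ≤ 1) :
    |boxSum T i j α β| ≤ 2 ^ n * (40 * ((n : ℝ) + 2) ^ (Ah + 1) / 2 ^ (2 * s₁)) := by
  -- reduce to `i ≤ j`
  wlog hij : i ≤ j generalizing i j α β
  · have h := this hj hi (by rwa [add_comm]) (by rwa [add_comm j i]) β α hβ hα (le_of_not_ge hij)
    rwa [boxSum_comm]
  set ρ : ℕ := 4 * ρ₄ with hρ
  set Λ : ℕ := i + j + 2 with hΛ
  set T' : Finset ℕ := T.filter (· < Λ) with hT'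
  have hT'Λ : ∀ x ∈ T', x < Λ := fun x hx => (Finset.mem_filter.1 hx).2
  rw [boxSum_eq_boxSum_filter T (le_refl (i + j + 2)) α β]
  -- numerics
  have hρ2 : 2 ≤ ρ := by omega
  have hi₀0 : 0 < i₀ := by omega
  have hρj : ρ ≤ j := by omega
  have hin : i < n := by omega
  have hE0 : (0 : ℝ) ≤ 40 * ((n : ℝ) + 2) ^ (Ah + 1) / 2 ^ (2 * s₁) := by positivity
  have hpow_ij : (2 : ℝ) ^ (i + j) ≤ 2 ^ n := pow_le_pow_right₀ one_le_two hijn.le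
  have hs₁ρ : (1 : ℝ) / 2 ^ ρ₄ ≤ 1 / 2 ^ (2 * s₁) :=
    one_div_le_one_div_of_le (by positivity) (pow_le_pow_right₀ one_le_two hs)
  have hn2 : (1 : ℝ) ≤ (n : ℝ) + 2 := by linarith [(Nat.cast_nonneg n : (0 : ℝ) ≤ n)]
  have hnA : (n : ℝ) ≤ ((n : ℝ) + 2) ^ (Ah + 1) := by
    calc (n : ℝ) ≤ (n : ℝ) + 2 := by linarith
      _ ≤ ((n : ℝ) + 2) ^ (Ah + 1) := le_self_pow₀ hn2 (by omega)
  have hnA' : ((n : ℝ) + 2) ^ Ah ≤ ((n : ℝ) + 2) ^ (Ah + 1) := pow_le_pow_right₀ hn2 (by omega)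
  have hΛn : ((Λ : ℕ) : ℝ) ≤ (n : ℝ) + 2 := by
    rw [hΛ]; push_cast
    have : ((i + j : ℕ) : ℝ) < n := by exact_mod_cast hijn
    push_cast at this; linarith
  -- the digits below `j - ρ + i` (the top `ρ + 2` digits are not covered by the core windows)
  set U : Finset ℕ := T'.filter (· < j - ρ + i) with hU
  have hUΛ : ∀ x ∈ U, x < j - ρ + i := fun x hx => (Finset.mem_filter.1 hx).2
  have hUT : U ⊆ T' := Finset.filter_subset _ _
  have hUcard : T'.card ≤ U.card + (ρ + 2) := by
    have hsplit := Finset.card_filter_add_card_filter_not (s := T') (· < j - ρ + i)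
    have h2 : (T'.filter fun x => ¬ x < j - ρ + i).card ≤ ρ + 2 := by
      calc (T'.filter fun x => ¬ x < j - ρ + i).card ≤ (Finset.Ico (j - ρ + i) Λ).card := by
            refine Finset.card_le_card fun x hx => ?_
            rw [Finset.mem_filter] at hx
            rw [Finset.mem_Ico]
            exact ⟨not_lt.1 hx.2, hT'Λ x hx.1⟩
        _ = Λ - (j - ρ + i) := Nat.card_Ico _ _
        _ ≤ ρ + 2 := by omega
    rw [← hU] at hsplit
    omega
  -- the pigeonhole over the windows
  have hcount : w * ((j - ρ - (i - ρ)) / i + 3) < U.card := by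
    have h1 : (j - ρ - (i - ρ)) / i ≤ n / i₀ := by
      calc (j - ρ - (i - ρ)) / i ≤ n / i := Nat.div_le_div_right (by omega)
        _ ≤ n / i₀ := Nat.div_le_div_left (by omega) hi₀0
    have h2 : w * ((j - ρ - (i - ρ)) / i + 3) ≤ w * (n / i₀ + 3) := by gcongr
    have h3 : (T.filter (· < i + j + 2)).card = T'.card := rfl
    omega
  rcases exists_heavy_window U hUΛ (b := i + ρ + 1 + ρ) (ℓ := i) (K₀ := i - ρ)
      (K₁ := j - ρ) (by omega) (by omega) (by omega) (by omega) hcount with hbot | ⟨K, hK₀, hK₁, hKw⟩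
  · -- the bottom window: `K = 0`
    have hbot' : w < (T'.filter (fun x => x < i + ρ + 1 + ρ)).card :=
      lt_of_lt_of_le hbot (Finset.card_le_card (Finset.filter_subset_filter _ hUT))
    have hsq := boxSum_sq_typeII_zero_bound T' (t := ρ) (ρ := ρ) le_rfl (by omega) hij α β hα hβ
    rw [mul_assoc] at hsq
    have hη := eta_bottom_le (ρ₄ := ρ₄) hw0 hbot'.le
    have hbr := bracket_bottom_le (ρ₄ := ρ₄) hρ₄ (by omega : 4 * ρ₄ + 2 * ρ₄ ≤ j) hη
    have hq : (((i + ρ + 1 + ρ : ℕ) : ℝ) + 1) ≤ 2 * n := by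
      have : ((i + ρ + 1 + ρ + 1 : ℕ) : ℝ) ≤ ((n + n : ℕ) : ℝ) := by
        exact_mod_cast (show i + ρ + 1 + ρ + 1 ≤ n + n by omega)
      push_cast at this ⊢; linarith
    have hZ : (((i + ρ + 1 + ρ : ℕ) : ℝ) + 1) ^ 2 *
        (324 / (2 : ℝ) ^ (ρ / 2) + 24 / 2 ^ ρ + 48 * 2 ^ ρ / 2 ^ j +
          32 * 2 ^ (54 * ρ + 3 * ρ) *
            (2 * (2 : ℝ) ^ (-(walshSupExponent * ((T'.filter (fun x => x < i + ρ + 1 + ρ)).card : ℝ)))) ^ 2) ≤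
        (2 * n * (20 / 2 ^ ρ₄)) ^ 2 := by
      rw [show (2 * (n : ℝ) * (20 / 2 ^ ρ₄)) ^ 2 = (2 * (n : ℝ)) ^ 2 * (20 / 2 ^ ρ₄) ^ 2 by ring]
      refine mul_le_mul (pow_le_pow_left₀ (by positivity) hq 2) hbr ?_ (by positivity)
      have : 0 ≤ (2 * (2 : ℝ) ^ (-(walshSupExponent *
        ((T'.filter (fun x => x < i + ρ + 1 + ρ)).card : ℝ)))) ^ 2 := sq_nonneg _
      positivity
    refine (abs_le_of_sq_le_four_pow hsq hZ (by positivity)).trans ?_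
    calc (2 : ℝ) ^ (i + j) * (2 * n * (20 / 2 ^ ρ₄)) = 2 ^ (i + j) * (40 * n * (1 / 2 ^ ρ₄)) := by ring
      _ ≤ 2 ^ n * (40 * ((n : ℝ) + 2) ^ (Ah + 1) * (1 / 2 ^ (2 * s₁))) := by gcongr
      _ = 2 ^ n * (40 * ((n : ℝ) + 2) ^ (Ah + 1) / 2 ^ (2 * s₁)) := by ring
  · -- a shifted window: `hHigh`
    have hKw' : w < (T'.filter fun x => K ≤ x ∧ x < K + i).card :=
      lt_of_lt_of_le hKw (Finset.card_le_card (Finset.filter_subset_filter _ hUT))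
    have hsq := hHigh T' i j ρ K (by omega) (by omega) hij (by omega) (by omega) α β hα hβ
    rw [mul_assoc] at hsq
    have hbr := bracket_high_le (ρ := ρ) hch hAi₀ hi hw1 hKw'
    have h3 := three_mul_two_rpow_le (ρ := ρ) (s₁ := s₁) hch4
    have hΛA : ((Λ : ℕ) : ℝ) ^ Ah ≤ ((n : ℝ) + 2) ^ Ah := pow_le_pow_left₀ (by positivity) hΛn Ah
    have hΛ1 : (1 : ℝ) ≤ ((n : ℝ) + 2) ^ Ah := one_le_pow₀ hn2
    have hZ : ((Λ : ℕ) : ℝ) ^ Ah *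
        ((2 : ℝ) ^ (-(ch * (ρ : ℕ))) + 2 ^ (Ah * ρ) * ((2 : ℝ) ^ (-(ch * (i : ℕ))) +
          (2 : ℝ) ^ (-(ch * ((T'.filter fun x => K ≤ x ∧ x < K + i).card : ℝ))))) ≤
        (((n : ℝ) + 2) ^ Ah * (2 / 2 ^ (2 * s₁))) ^ 2 := by
      calc _ ≤ ((n : ℝ) + 2) ^ Ah * (3 * (2 : ℝ) ^ (-(ch * (ρ : ℕ)))) :=
            mul_le_mul hΛA hbr (by positivity) (by positivity)
        _ ≤ (((n : ℝ) + 2) ^ Ah) ^ 2 * (2 / 2 ^ (2 * s₁)) ^ 2 := by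
            refine mul_le_mul ?_ h3 (by positivity) (by positivity)
            calc ((n : ℝ) + 2) ^ Ah = ((n : ℝ) + 2) ^ Ah * 1 := (mul_one _).symm
              _ ≤ ((n : ℝ) + 2) ^ Ah * ((n : ℝ) + 2) ^ Ah := by gcongr
              _ = (((n : ℝ) + 2) ^ Ah) ^ 2 := by ring
        _ = (((n : ℝ) + 2) ^ Ah * (2 / 2 ^ (2 * s₁))) ^ 2 := by ring
    refine (abs_le_of_sq_le_four_pow hsq hZ (by positivity)).trans ?_
    calc (2 : ℝ) ^ (i + j) * (((n : ℝ) + 2) ^ Ah * (2 / 2 ^ (2 * s₁)))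
        = 2 ^ (i + j) * (2 * ((n : ℝ) + 2) ^ Ah * (1 / 2 ^ (2 * s₁))) := by ring
      _ ≤ 2 ^ n * (40 * ((n : ℝ) + 2) ^ (Ah + 1) * (1 / 2 ^ (2 * s₁))) := by gcongr; norm_num
      _ = 2 ^ n * (40 * ((n : ℝ) + 2) ^ (Ah + 1) / 2 ^ (2 * s₁)) := by ring


/-! ### The type-I boxes (Bourgain 2013, §3 and (2.35)) -/

set_option maxHeartbeats 800000 in
/-- **A large type-I box with a heavy digit set** (Bourgain 2013, §3). Same hypothesis `hHigh`;
parameters `ρ = 4ρ₄`, `4s₁ ≤ ch ρ`, thresholds `i₁ ≥ ρ, Aρ` with `ch·i₁ ≥ (A+ch)ρ`,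
`ch·w ≥ (A+ch)ρ`, a digit count `s_I` with `c₂ s_I ≥ i₁ + 2s₁`, `c₂ s_I ≥ 4s₁`,
`c₂ s_I ≥ 8b(w+ρ+3)` where `2n + 2 ≤ 2^b`, and `6i₀ + ρ + 2 ≤ n`: every box `i ≤ 2i₀`,
`i + j < n ≤ i + j + ρ`, whose digit set has `≥ s_I` digits below `i + j + 2`, satisfies
`|boxSum T i j c 1| ≤ 2ⁿ · 12(n+2)^{A+3}/2^{s₁}` for every `|c| ≤ τ`: the crude regime `i ≤ i₁`
((3.2')–(3.3)), the refined regime ((3.4), (3.8)–(3.9)) when the top digits `T ∩ [j-i, i+j+2)`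
are few, and otherwise ((2.35)) one of the two top windows `[j-i, ·)`, `[j-ρ, ·)` is heavy and
`hHigh` applies to the box with sign coefficients.
[cite: Bourgain2013MoebiusWalsh, §3 (3.1)–(3.4), (3.9); §2 (2.35)] -/
theorem typeI_box_le {Ah : ℕ} {ch : ℝ} (hch : 0 < ch)
    (hHigh : ∀ (T : Finset ℕ) (i j ρ K : ℕ), 1 ≤ ρ → Ah * ρ ≤ i → i ≤ j → i ≤ K + ρ → K + ρ ≤ j →
      ∀ (α β : ℕ → ℝ), (∀ a, |α a| ≤ 1) → (∀ b, |β b| ≤ 1) →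
        (boxSum T i j α β) ^ 2 ≤ 4 ^ (i + j) * ((i + j + 2 : ℕ) : ℝ) ^ Ah *
          ((2 : ℝ) ^ (-(ch * ρ)) + 2 ^ (Ah * ρ) * ((2 : ℝ) ^ (-(ch * i)) +
            (2 : ℝ) ^ (-(ch * ((T.filter (fun x => K ≤ x ∧ x < K + i)).card : ℝ))))))
    {n ρ₄ s₁ w i₀ i₁ sI b : ℕ} (hρ₄ : 1 ≤ ρ₄) (hch4 : (4 * s₁ : ℝ) ≤ ch * (4 * ρ₄ : ℕ))
    (hAρ : Ah * (4 * ρ₄) ≤ i₁) (hρi₁ : 4 * ρ₄ ≤ i₁)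
    (hAi₁ : (Ah : ℝ) * (4 * ρ₄ : ℕ) + ch * (4 * ρ₄ : ℕ) ≤ ch * i₁)
    (hw1 : (Ah : ℝ) * (4 * ρ₄ : ℕ) + ch * (4 * ρ₄ : ℕ) ≤ ch * w)
    (hi₁c : (i₁ : ℝ) + 2 * s₁ ≤ walshSupExponent * sI) (h4s : (4 * s₁ : ℝ) ≤ walshSupExponent * sI)
    (hb : 2 * n + 2 ≤ 2 ^ b) (hb1 : 1 ≤ b)
    (hwI : ((w : ℝ) + (4 * ρ₄ : ℕ) + 3) * (8 * b) ≤ walshSupExponent * sI)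
    (hi₀n : 6 * i₀ + 4 * ρ₄ + 2 ≤ n)
    (T : Finset ℕ) {i j : ℕ} (hi : i ≤ 2 * i₀) (hijn : i + j < n) (hnij : n ≤ i + j + 4 * ρ₄)
    (hT : sI ≤ (T.filter (· < i + j + 2)).card)
    {c : ℕ → ℝ} (hc : ∀ a, |c a| ≤ (σ 0 a : ℝ)) :
    |boxSum T i j c (fun _ => 1)| ≤ 2 ^ n * (12 * ((n : ℝ) + 2) ^ (Ah + 3) / 2 ^ s₁) := by
  set ρ : ℕ := 4 * ρ₄ with hρ
  set Λ : ℕ := i + j + 2 with hΛ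
  set T' : Finset ℕ := T.filter (· < Λ) with hT'
  have hT'Λ : ∀ x ∈ T', x < Λ := fun x hx => (Finset.mem_filter.1 hx).2
  have hT'Λ' : ∀ x ∈ T', x < i + j + 2 := hT'Λ
  rw [boxSum_eq_boxSum_filter T (le_refl (i + j + 2)) c]
  -- numerics
  have hc₂ : 0 < walshSupExponent := walshSupExponent_pos
  have hρ2 : 2 ≤ ρ := by omega
  have h2ij : 2 * i + 2 ≤ j := by omega
  have hij : i ≤ j := by omega
  have hin : i < n := by omega
  have hpow_ij : (2 : ℝ) ^ (i + j) ≤ 2 ^ n := pow_le_pow_right₀ one_le_two hijn.le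
  have hn2 : (1 : ℝ) ≤ (n : ℝ) + 2 := by linarith [(Nat.cast_nonneg n : (0 : ℝ) ≤ n)]
  have hΛn : ((Λ : ℕ) : ℝ) ≤ (n : ℝ) + 2 := by
    rw [hΛ]; push_cast
    have : ((i + j : ℕ) : ℝ) < n := by exact_mod_cast hijn
    push_cast at this; linarith
  have hΛ1 : (1 : ℝ) ≤ ((Λ : ℕ) : ℝ) := by rw [hΛ]; push_cast; linarith [(Nat.cast_nonneg (i + j) : (0:ℝ) ≤ (i + j : ℕ))]
  have hi2 : ((i : ℝ) + 2) ≤ (n : ℝ) + 2 := by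
    have : (i : ℝ) < n := by exact_mod_cast hin
    linarith
  have hcardT : (sI : ℝ) ≤ T'.card := by exact_mod_cast hT
  have hA3 : ((n : ℝ) + 2) ^ 3 ≤ ((n : ℝ) + 2) ^ (Ah + 3) := pow_le_pow_right₀ hn2 (by omega)
  -- the target in the form `2^{i+j} · 2(i+2)² · √Y ≤ …` for `√Y ≤ P / 2^{s₁}`
  have hfinish : ∀ {Y P : ℝ}, 0 ≤ P → Real.sqrt Y ≤ P / 2 ^ s₁ →
      2 * P * ((n : ℝ) + 2) ^ 2 ≤ 12 * ((n : ℝ) + 2) ^ (Ah + 3) →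
      2 ^ (i + j) * (2 * ((i : ℝ) + 2) ^ 2) * Real.sqrt Y ≤ 2 ^ n * (12 * ((n : ℝ) + 2) ^ (Ah + 3) / 2 ^ s₁) := by
    intro Y P hP hY hP12
    calc 2 ^ (i + j) * (2 * ((i : ℝ) + 2) ^ 2) * Real.sqrt Y
        ≤ 2 ^ n * (2 * ((n : ℝ) + 2) ^ 2) * (P / 2 ^ s₁) := by gcongr
      _ = 2 ^ n * ((2 * P * ((n : ℝ) + 2) ^ 2) / 2 ^ s₁) := by ring
      _ ≤ 2 ^ n * (12 * ((n : ℝ) + 2) ^ (Ah + 3) / 2 ^ s₁) := by gcongr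
  rcases le_or_gt i i₁ with hii₁ | hii₁
  · -- crude regime (3.2')–(3.3)
    have hF := sum_abs_le_crude T' hT'Λ'
    set η : ℝ := 2 * (2 : ℝ) ^ (-(walshSupExponent * (T'.card : ℝ))) with hη
    have hY0 : 0 ≤ 8 * (((i + j + 2 : ℕ) : ℝ) + 2) * 2 ^ i * η := by positivity
    refine (abs_boxSum_divisorBounded_le_of_sum_abs T' i j hc hY0 hF).trans (hfinish (P := 4 * ((n : ℝ) + 3))
      (by positivity) ?_ ?_)
    swap
    · calc 2 * (4 * ((n : ℝ) + 3)) * ((n : ℝ) + 2) ^ 2 ≤ 12 * ((n : ℝ) + 2) ^ 3 := by nlinarith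
        _ ≤ 12 * ((n : ℝ) + 2) ^ (Ah + 3) := by gcongr
    -- `√Y ≤ 4(n+3)/2^{s₁}`: `Y ≤ 16(n+3)/4^{s₁}`
    have hsave : (2 : ℝ) ^ i * η ≤ 2 * (1 / 2 ^ (2 * s₁)) := by
      rw [hη, show (2 : ℝ) ^ i * (2 * (2 : ℝ) ^ (-(walshSupExponent * (T'.card : ℝ)))) =
        2 * ((2 : ℝ) ^ i * (2 : ℝ) ^ (-(walshSupExponent * (T'.card : ℝ)))) by ring, two_pow_eq_rpow i,
        two_rpow_mul_two_rpow, one_div, two_pow_eq_rpow (2 * s₁), ← Real.rpow_neg (by norm_num)]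
      refine mul_le_mul_of_nonneg_left (two_rpow_le_two_rpow ?_) (by norm_num)
      have h1 : (i : ℝ) ≤ i₁ := by exact_mod_cast hii₁
      have h2 : walshSupExponent * sI ≤ walshSupExponent * T'.card := mul_le_mul_of_nonneg_left hcardT hc₂.le
      push_cast; linarith
    have hY : 8 * (((i + j + 2 : ℕ) : ℝ) + 2) * 2 ^ i * η ≤ (4 * ((n : ℝ) + 3) / 2 ^ s₁) ^ 2 := by
      have hΛ3 : ((i + j + 2 : ℕ) : ℝ) + 2 ≤ (n : ℝ) + 3 := by
        have : ((i + j + 1 : ℕ) : ℝ) ≤ n := by exact_mod_cast hijn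
        push_cast at this ⊢; linarith
      have hD : ((2 : ℝ) ^ s₁) ^ 2 = 2 ^ (2 * s₁) := by rw [← pow_mul, mul_comm]
      have hsq : ((4 * ((n : ℝ) + 3)) / 2 ^ s₁) ^ 2 = 16 * ((n : ℝ) + 3) ^ 2 * (1 / 2 ^ (2 * s₁)) := by
        rw [div_pow, hD]; ring
      rw [hsq]
      have hn3 : (1 : ℝ) ≤ (n : ℝ) + 3 := by linarith
      calc 8 * (((i + j + 2 : ℕ) : ℝ) + 2) * 2 ^ i * η = 8 * (((i + j + 2 : ℕ) : ℝ) + 2) * (2 ^ i * η) := by ring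
        _ ≤ 8 * ((n : ℝ) + 3) * (2 * (1 / 2 ^ (2 * s₁))) := by gcongr
        _ = 16 * ((n : ℝ) + 3) * (1 / 2 ^ (2 * s₁)) := by ring
        _ ≤ 16 * ((n : ℝ) + 3) ^ 2 * (1 / 2 ^ (2 * s₁)) := by
            gcongr; nlinarith
    calc Real.sqrt (8 * (((i + j + 2 : ℕ) : ℝ) + 2) * 2 ^ i * η)
        ≤ Real.sqrt ((4 * ((n : ℝ) + 3) / 2 ^ s₁) ^ 2) := Real.sqrt_le_sqrt hY
      _ = 4 * ((n : ℝ) + 3) / 2 ^ s₁ := Real.sqrt_sq (by positivity)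
  · -- `i > i₁`: refined regime or a heavy top window
    set T₂ : Finset ℕ := T'.filter (fun t => ¬ t < j - i) with hT₂
    by_cases hR : (b : ℝ) * (T'.filter fun t => ¬ t < j - i).card ≤ walshSupExponent * T'.card / 4
    · -- refined regime (3.4), (3.8)–(3.9)
      have hF := sum_abs_le_refined T' hT'Λ' hij
      have hbΛ : 2 * (i + j + 2) ≤ 2 ^ b := by omega
      have hsave := refined_saving_le T' (j - i) hbΛ hb1 hR
      set Y : ℝ := 2 * ((i + j + 2 : ℕ) : ℝ) *
        (2 * ((i + j + 2 : ℕ) : ℝ)) ^ (T'.filter fun t => ¬ t < j - i).card *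
        (2 * (2 : ℝ) ^ (-(walshSupExponent * ((T'.filter (· < j - i)).card : ℝ)))) with hYdef
      have hY0 : 0 ≤ Y := by rw [hYdef]; positivity
      refine (abs_boxSum_divisorBounded_le_of_sum_abs T' i j hc hY0 hF).trans (hfinish (P := 2 * ((n : ℝ) + 2))
        (by positivity) ?_ ?_)
      swap
      · calc 2 * (2 * ((n : ℝ) + 2)) * ((n : ℝ) + 2) ^ 2 = 4 * ((n : ℝ) + 2) ^ 3 := by ring
          _ ≤ 12 * ((n : ℝ) + 2) ^ 3 := by gcongr; norm_num
          _ ≤ 12 * ((n : ℝ) + 2) ^ (Ah + 3) := by gcongr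
      have h2s : (2 : ℝ) ^ (-(walshSupExponent * T'.card / 2)) ≤ 1 / 2 ^ (2 * s₁) := by
        rw [one_div, two_pow_eq_rpow (2 * s₁), ← Real.rpow_neg (by norm_num)]
        refine two_rpow_le_two_rpow ?_
        have h2 : walshSupExponent * sI ≤ walshSupExponent * T'.card := mul_le_mul_of_nonneg_left hcardT hc₂.le
        push_cast; linarith
      have hY : Y ≤ (2 * ((n : ℝ) + 2) / 2 ^ s₁) ^ 2 := by
        have hD : ((2 : ℝ) ^ s₁) ^ 2 = 2 ^ (2 * s₁) := by rw [← pow_mul, mul_comm]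
        have hsq : (2 * ((n : ℝ) + 2) / 2 ^ s₁) ^ 2 = 4 * ((n : ℝ) + 2) ^ 2 * (1 / 2 ^ (2 * s₁)) := by
          rw [div_pow, hD]; ring
        rw [hsq, hYdef]
        calc 2 * ((i + j + 2 : ℕ) : ℝ) * (2 * ((i + j + 2 : ℕ) : ℝ)) ^ (T'.filter fun t => ¬ t < j - i).card *
              (2 * (2 : ℝ) ^ (-(walshSupExponent * ((T'.filter (· < j - i)).card : ℝ))))
            = 2 * ((i + j + 2 : ℕ) : ℝ) * ((2 * ((i + j + 2 : ℕ) : ℝ)) ^ (T'.filter fun t => ¬ t < j - i).card *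
              (2 * (2 : ℝ) ^ (-(walshSupExponent * ((T'.filter (· < j - i)).card : ℝ))))) := by ring
          _ ≤ 2 * ((n : ℝ) + 2) * (2 * (2 : ℝ) ^ (-(walshSupExponent * T'.card / 2))) := by gcongr
          _ ≤ 2 * ((n : ℝ) + 2) * (2 * (1 / 2 ^ (2 * s₁))) := by gcongr
          _ = 4 * ((n : ℝ) + 2) * (1 / 2 ^ (2 * s₁)) := by ring
          _ ≤ 4 * ((n : ℝ) + 2) ^ 2 * (1 / 2 ^ (2 * s₁)) := by gcongr; nlinarith
      calc Real.sqrt Y ≤ Real.sqrt ((2 * ((n : ℝ) + 2) / 2 ^ s₁) ^ 2) := Real.sqrt_le_sqrt hY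
        _ = 2 * ((n : ℝ) + 2) / 2 ^ s₁ := Real.sqrt_sq (by positivity)
    · -- a heavy top window: (2.35)
      rw [not_le] at hR
      have hb0 : (0 : ℝ) < b := by exact_mod_cast hb1
      -- one of the two top core windows `[j-i, j)`, `[j-ρ, j-ρ+i)` carries more than `w` digits
      set U : Finset ℕ := T₂.filter (· < j - ρ + i) with hUdef
      have hU : ∀ x ∈ U, j - i ≤ x ∧ x < j - ρ + i := by
        intro x hx
        rw [hUdef, Finset.mem_filter, hT₂, Finset.mem_filter] at hx
        exact ⟨not_lt.1 hx.1.2, hx.2⟩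
      have hUT₂ : U ⊆ T₂ := Finset.filter_subset _ _
      have hT₂T' : T₂ ⊆ T' := by rw [hT₂]; exact Finset.filter_subset _ _
      have hUcard : T₂.card ≤ U.card + (ρ + 2) := by
        have hsplit := Finset.card_filter_add_card_filter_not (s := T₂) (· < j - ρ + i)
        have h2 : (T₂.filter fun x => ¬ x < j - ρ + i).card ≤ ρ + 2 := by
          calc (T₂.filter fun x => ¬ x < j - ρ + i).card ≤ (Finset.Ico (j - ρ + i) Λ).card := by
                refine Finset.card_le_card fun x hx => ?_
                rw [Finset.mem_filter] at hx
                rw [Finset.mem_Ico]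
                exact ⟨not_lt.1 hx.2, hT'Λ x (hT₂T' hx.1)⟩
            _ = Λ - (j - ρ + i) := Nat.card_Ico _ _
            _ ≤ ρ + 2 := by omega
        rw [← hUdef] at hsplit
        omega
      have hK : ∃ K, (i ≤ K + ρ ∧ K + ρ ≤ j) ∧
          w < (T'.filter fun x => K ≤ x ∧ x < K + i).card := by
        have hmono : ∀ K, (U.filter fun x => K ≤ x ∧ x < K + i).card ≤
            (T'.filter fun x => K ≤ x ∧ x < K + i).card := fun K =>
          Finset.card_le_card (Finset.filter_subset_filter _ (hUT₂.trans hT₂T'))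
        have hbig : ∀ K, U.card ≤ 2 * (U.filter fun x => K ≤ x ∧ x < K + i).card →
            w < (T'.filter fun x => K ≤ x ∧ x < K + i).card := by
          intro K hK2
          set cnt : ℕ := (U.filter fun x => K ≤ x ∧ x < K + i).card with hcnt
          have h3 : ((T'.filter fun t => ¬ t < j - i).card : ℝ) ≤ 2 * cnt + ((ρ : ℕ) : ℝ) + 2 := by
            rw [← hT₂]
            have : ((T₂.card : ℕ) : ℝ) ≤ ((U.card + (ρ + 2) : ℕ) : ℝ) := by exact_mod_cast hUcard
            have h' : ((U.card : ℕ) : ℝ) ≤ ((2 * cnt : ℕ) : ℝ) := by exact_mod_cast hK2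
            push_cast at this h' ⊢
            linarith
          have h4 : walshSupExponent * sI ≤ walshSupExponent * T'.card :=
            mul_le_mul_of_nonneg_left hcardT hc₂.le
          have h5 : (b : ℝ) * (T'.filter fun t => ¬ t < j - i).card ≤ (b : ℝ) * (2 * cnt + ((ρ : ℕ) : ℝ) + 2) :=
            mul_le_mul_of_nonneg_left h3 hb0.le
          have hA : ((w : ℝ) + 1) * (8 * b) < (cnt : ℝ) * (8 * b) := by
            have hρ4 : ((ρ : ℕ) : ℝ) = ((4 * ρ₄ : ℕ) : ℝ) := by rw [hρ]
            rw [hρ4] at h5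
            have hbρ : 0 ≤ (b : ℝ) * ((4 * ρ₄ : ℕ) : ℝ) := by positivity
            linarith
          have h6 : (w : ℝ) + 1 < cnt := lt_of_mul_lt_mul_right hA (by positivity)
          have h7 : w < cnt := by exact_mod_cast (show ((w : ℕ) : ℝ) < cnt by linarith)
          exact lt_of_lt_of_le h7 (hmono K)
        rcases card_le_two_mul_window_or U hU (K := j - i) (K' := j - ρ) (ℓ := i)
            (by omega) (by omega) with h | h
        · exact ⟨j - i, ⟨by omega, by omega⟩, hbig _ h⟩
        · exact ⟨j - ρ, ⟨by omega, by omega⟩, hbig _ h⟩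
      obtain ⟨K, ⟨hK1, hK2⟩, hKw⟩ := hK
      -- `hHigh` for the box with coefficients of modulus `≤ 1`
      have hbr : ∀ cnt : ℕ, w < cnt →
          (2 : ℝ) ^ (-(ch * (ρ : ℕ))) + 2 ^ (Ah * ρ) * ((2 : ℝ) ^ (-(ch * (i : ℕ))) + (2 : ℝ) ^ (-(ch * (cnt : ℝ)))) ≤
            3 * (2 : ℝ) ^ (-(ch * (ρ : ℕ))) := fun cnt hcnt =>
        bracket_high_le (ρ := ρ) hch hAi₁ hii₁.le hw1 hcnt
      have h3 := three_mul_two_rpow_le (ρ := ρ) (s₁ := s₁) hch4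
      have hΛA : ((i + j + 2 : ℕ) : ℝ) ^ Ah ≤ ((n : ℝ) + 2) ^ Ah := pow_le_pow_left₀ (by positivity) hΛn Ah
      have hnA1 : (1 : ℝ) ≤ ((n : ℝ) + 2) ^ Ah := one_le_pow₀ hn2
      set Yc : ℝ := ((n : ℝ) + 2) ^ Ah * (2 / 2 ^ (2 * s₁)) with hYc
      have hYc0 : 0 ≤ Yc := by rw [hYc]; positivity
      have hII : ∀ α : ℕ → ℝ, (∀ a, |α a| ≤ 1) → boxSum T' i j α (fun _ => 1) ≤ 2 ^ (i + j) * Yc := by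
        intro α hα
        have hsq := hHigh T' i j ρ K (by omega) (by omega) hij hK1 hK2 α (fun _ => 1) hα (fun _ => by simp)
        rw [mul_assoc] at hsq
        have hZ : ((i + j + 2 : ℕ) : ℝ) ^ Ah *
            ((2 : ℝ) ^ (-(ch * (ρ : ℕ))) + 2 ^ (Ah * ρ) * ((2 : ℝ) ^ (-(ch * (i : ℕ))) +
              (2 : ℝ) ^ (-(ch * ((T'.filter fun x => K ≤ x ∧ x < K + i).card : ℝ))))) ≤
            Yc ^ 2 := by
          calc _ ≤ ((n : ℝ) + 2) ^ Ah * (3 * (2 : ℝ) ^ (-(ch * (ρ : ℕ)))) :=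
                mul_le_mul hΛA (hbr _ hKw) (by positivity) (by positivity)
            _ ≤ (((n : ℝ) + 2) ^ Ah) ^ 2 * (2 / 2 ^ (2 * s₁)) ^ 2 := by
                refine mul_le_mul ?_ h3 (by positivity) (by positivity)
                calc ((n : ℝ) + 2) ^ Ah = ((n : ℝ) + 2) ^ Ah * 1 := (mul_one _).symm
                  _ ≤ ((n : ℝ) + 2) ^ Ah * ((n : ℝ) + 2) ^ Ah := by gcongr
                  _ = (((n : ℝ) + 2) ^ Ah) ^ 2 := by ring
            _ = Yc ^ 2 := by rw [hYc]; ring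
        exact (le_abs_self _).trans (abs_le_of_sq_le_four_pow hsq hZ hYc0)
      refine (abs_boxSum_divisorBounded_le_of_typeII T' i j hc hYc0 hII).trans
        (hfinish (P := 2 * ((n : ℝ) + 2) ^ (Ah + 1)) (by positivity) ?_ ?_)
      · -- `√Yc ≤ 2(n+2)^{A+1}/2^{s₁}`
        have hYc1 : Yc ≤ (2 * ((n : ℝ) + 2) ^ Ah) * (1 / 2 ^ (2 * s₁)) := by rw [hYc]; apply le_of_eq; ring
        have hD : ((2 : ℝ) ^ s₁) ^ 2 = 2 ^ (2 * s₁) := by rw [← pow_mul, mul_comm]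
        have hsq : ((2 * ((n : ℝ) + 2) ^ Ah) / 2 ^ s₁) ^ 2 = (2 * ((n : ℝ) + 2) ^ Ah) ^ 2 * (1 / 2 ^ (2 * s₁)) := by
          rw [div_pow, hD]; ring
        have hY : Yc ≤ ((2 * ((n : ℝ) + 2) ^ Ah) / 2 ^ s₁) ^ 2 := by
          rw [hsq]
          refine hYc1.trans (mul_le_mul_of_nonneg_right ?_ (by positivity))
          nlinarith
        calc Real.sqrt Yc ≤ Real.sqrt (((2 * ((n : ℝ) + 2) ^ Ah) / 2 ^ s₁) ^ 2) := Real.sqrt_le_sqrt hY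
          _ = (2 * ((n : ℝ) + 2) ^ Ah) / 2 ^ s₁ := Real.sqrt_sq (by positivity)
          _ ≤ 2 * ((n : ℝ) + 2) ^ (Ah + 1) / 2 ^ s₁ := by
              gcongr
              exact Nat.le_succ Ah
      · calc 2 * (2 * ((n : ℝ) + 2) ^ (Ah + 1)) * ((n : ℝ) + 2) ^ 2 = 4 * ((n : ℝ) + 2) ^ (Ah + 3) := by ring
          _ ≤ 12 * ((n : ℝ) + 2) ^ (Ah + 3) := by gcongr; norm_num

end Literature.NumberTheory.LFunctions.MoebiusWalshTypeII
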